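import Summits.FinalStateConjecture.FinalStateConjecture.Theorems.PhaseMixingCaptureNearExtremalKappaCaptureThermalTimeStabilityCentre
import Summits.FinalStateConjecture.FinalStateConjecture.Theorems.EIHFluxBalanceModulatedKerrHandoffKerrHelix
import Literature.Geometry.Lorentzian.CausalityPushUp
import HarnessLib

/-!
# Crux `ClusterCompleteness.OmegaLimitMultiKerr` (stmt-FinalStateConjecture-14664), line `Sketch` —
# N = 1 exact-Kerr certificate, part 2/3: DRSR-helix causal geometry of the Kerr slab development
# (registered stub `kerrSlab_helix`)

The crux's recurrence interface is certified on the EXACT sub-extremal Kerr black hole (`0 < M`,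
`|a| < M`), realised as the vacuum Cauchy development
`KerrSlab.development hM ha : VacuumCauchyDevelopment (Kerr.data M a M hM.le)` of
`PhaseMixingCaptureNearExtremalKappaCaptureThermalTimeStabilityCentre.lean`: the Kerr chart
`(Kerr.region a M, g_{M,a}, −g♯dt*)` restricted (`DataEmbedding.restrict`) to the open slab domain
`KerrSlab.domain a M = {0 < t* + (r − M)/4} ⊇ {t* ≥ 0}`, with data slice `{t* = 0}`.

This file proves the causal-geometric input `kerrSlab_helix` of the certificate, read off the DRSR
helices `s ↦ (t* + s, R_z(ω s) x⃗)`, `ω = 2Mar/(r² + a²)²`, through the points with `r > r₊`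
(Dafermos–Rodnianski–Shlapentokh-Rothman, arXiv:1402.7034, Lemma 4.7.1: the span of the stationary and
axial Killing fields is timelike off the event horizon; landed as
`Cruxes.ModulatedKerrHandoff.SwallowTransfer.stub_kerrHelix`: a future-timelike chart curve on all of
`ℝ` at constant Kerr–Schild radius with lab time `p⁰ + s`):

* (a) every point `p` of the development with `r(p) > r₊` and `t*(p) > 0` lies in the causal future
  `J⁺` of the data slice — the helix through `p` run backwards for parameter time `t*(p)` starts on
  the slice `{t* = 0}` (`KerrSlab.exists_sliceEmbed_eq_iff`), so `p ∈ I⁺(ι X) ⊆ J⁺(ι X)`;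
* (b) from every point `p` with `r(p) > r₊`, `t*(p) ≥ 0`, every later chart time `T > t*(p)` is
  reached at the same Kerr–Schild radius inside `I⁺(p)` — the helix run forwards for parameter time
  `T − t*(p)`.

The only plumbing is `isFutureTimelikeCurveOn_lift`: a future-timelike chart curve, pushed into the
carrier `↥(KerrSlab.domain a M)` (junk value off the domain), is a future-timelike curve of the
development on every parameter set mapped into the domain — the timelike condition is a germ
condition (`LorentzianMetric.timelike_of_eventuallyEq`), the domain is open, and the curves of an open
sub-spacetime are those of the ambient one (`LorentzianMetric.isFutureTimelikeCurveOn_restrict_iff`,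
O'Neill 1983, Ch. 1, pp. 3–7). The half-chart `{t* ≥ 0}` lies in the domain
(`KerrSlab.mem_domain_of_nonneg`), and lab time is `p⁰ + s ≥ 0` along the parameter ranges used.

Nothing else is proved or restated here (the exact chart, the exhaustion/no-escape statement and the
assembly of the certificate are separate files of the line); no named fact is consumed
(`[Kerr.Facts]`, `[Kerr.SliceFacts]` are the standing instance hypotheses of `Kerr.data`).

References: M. Dafermos, I. Rodnianski, Y. Shlapentokh-Rothman, arXiv:1402.7034, Lemma 4.7.1;
B. O'Neill, *Semi-Riemannian geometry* (1983), Ch. 14, pp. 402–403 (`I⁺`, `J⁺`, `I⁺ ⊆ J⁺`), Ch. 1,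
pp. 3–7 (open submanifolds); J. Sbierski, Ann. Henri Poincaré 17 (2016), Def. 2.4.
-/

-- every `Summit.FinalStateConjecture.FinalStateConjecture.…` name repeats the summit = sub-problem segment (D-0017 layout)
set_option linter.dupNamespace false

noncomputable section

open scoped Manifold ContDiff Topology ENNReal
open Set Filter TopologicalSpace Function

namespace Summit.FinalStateConjecture.FinalStateConjecture.Theorems.ClusterCompleteness

open Literature.Geometry.Lorentzian
open Summit.FinalStateConjecture.FinalStateConjecture.Theorems.NearExtremalKappaCapture.UnitTemperatureFrontFace
open Summit.FinalStateConjecture.FinalStateConjecture.Cruxes.ModulatedKerrHandoff.SwallowTransfer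
  (stub_kerrHelix)

/-- **Lifting chart curves into the Kerr slab development.** Let `γ : ℝ → Kerr.region a M` be a
future-timelike curve of the Kerr chart `(g_{M,a}, −g♯dt*)` on all of `ℝ`, and `μ` a curve in the
carrier `↥(KerrSlab.domain a M)` of `KerrSlab.development hM ha` which agrees with `γ` at every
parameter mapped into the (open) slab domain. Then `μ` is a future-timelike curve of the development
on every parameter set `S` that `γ` maps into the domain: near such a parameter `val ∘ μ = γ`
(continuity of `γ`), the timelike condition is a germ condition
(`LorentzianMetric.timelike_of_eventuallyEq`), and the future-timelike curves of an open
sub-spacetime are those of the ambient spacetime lying in it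
(`LorentzianMetric.isFutureTimelikeCurveOn_restrict_iff`; O'Neill 1983, Ch. 1, pp. 3–7). [folklore] -/
theorem isFutureTimelikeCurveOn_lift [Kerr.Facts] [Kerr.SliceFacts] {M a : ℝ} (hM : 0 < M)
    (ha : |a| < M) {γ : ℝ → Kerr.region a M}
    (hγ : (Kerr.smoothMetric M a M).IsFutureTimelikeCurveOn
      ((Kerr.timeOrientation M a M hM.le).ofLE le_top) γ univ)
    {μ : ℝ → (KerrSlab.development hM ha).carrier}
    (hμ : ∀ s, γ s ∈ KerrSlab.domain a M → (μ s).1 = γ s) {S : Set ℝ}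
    (hS : ∀ s ∈ S, γ s ∈ KerrSlab.domain a M) :
    (KerrSlab.development hM ha).metric.IsFutureTimelikeCurveOn
      (KerrSlab.development hM ha).timeOrientation μ S := by
  refine (LorentzianMetric.isFutureTimelikeCurveOn_restrict_iff _ _ _ _ _).2 fun t ht ↦ ?_
  obtain ⟨hd, h1, h2⟩ := hγ t (mem_univ t)
  have hev : (Subtype.val ∘ μ) =ᶠ[𝓝 t] γ := by
    filter_upwards [hd.continuousAt.preimage_mem_nhds ((KerrSlab.domain a M).2.mem_nhds (hS t ht))]
      with t' ht' using hμ t' ht'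
  exact LorentzianMetric.timelike_of_eventuallyEq hev hd h1 h2

/-- **Causal geometry of the Kerr slab development along the DRSR helices**
`s ↦ (t* + s, R_z(ω s) x⃗)`, `ω = 2Mar/(r² + a²)²` (registered stub `kerrSlab_helix` of the `N = 1`
exact-Kerr certificate). For `0 < M`, `|a| < M` and the vacuum Cauchy development
`KerrSlab.development hM ha` of the exact Kerr data: (a) every point with `r > r₊`, `t* > 0` lies in
the causal future of the data slice `range ι` — the helix through it, run backwards for parameter
time `t*`, starts on `{t* = 0}`, so the point is in `I⁺(range ι) ⊆ J⁺(range ι)`; (b) from every point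
`p` with `r > r₊`, `t* ≥ 0`, every later chart time `T` is reached, at the same Kerr–Schild radius,
inside `I⁺(p)` — the helix run forwards for parameter time `T − t*(p)`. The helices are the
future-timelike chart curves of `Cruxes.ModulatedKerrHandoff.SwallowTransfer.stub_kerrHelix`
(Dafermos–Rodnianski–Shlapentokh-Rothman, arXiv:1402.7034, Lemma 4.7.1), lifted into the development by
`isFutureTimelikeCurveOn_lift` (the half-chart `{t* ≥ 0}` lies in the slab domain).
[cite: DafermosRodnianskiShlapentokhrothman2014, Lemma 4.7.1] -/
theorem kerrSlab_helix : ∀ [Kerr.Facts] [Kerr.SliceFacts] {M a : ℝ} (hM : 0 < M) (ha : |a| < M),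
    (∀ p : (KerrSlab.development hM ha).carrier,
      Kerr.rPlus M a < Kerr.radius a p.1.1 → 0 < p.1.1 0 →
        p ∈ (KerrSlab.development hM ha).metric.causalFuture
          (KerrSlab.development hM ha).timeOrientation (range (KerrSlab.development hM ha).embed)) ∧
    ∀ p : (KerrSlab.development hM ha).carrier,
      Kerr.rPlus M a < Kerr.radius a p.1.1 → 0 ≤ p.1.1 0 → ∀ T : ℝ, p.1.1 0 < T →
        ∃ q : (KerrSlab.development hM ha).carrier,
          Kerr.radius a q.1.1 = Kerr.radius a p.1.1 ∧ q.1.1 0 = T ∧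
            q ∈ (KerrSlab.development hM ha).metric.chronologicalFuture
              (KerrSlab.development hM ha).timeOrientation {p} := by
  intro _ _ M a hM ha
  classical
  refine ⟨fun p hr hp0 ↦ ?_, fun p hr hp0 T hT ↦ ?_⟩
  · -- (a): the helix through `p`, run backwards for parameter time `p⁰`, starts on the slice
    obtain ⟨γ, hγ0, hγt, -, hγ⟩ := stub_kerrHelix M a M hM.le ha p.1 hr
    have hmem : ∀ s, -(p.1.1 0) ≤ s → γ s ∈ KerrSlab.domain a M := fun s hs ↦
      KerrSlab.mem_domain_of_nonneg (by rw [hγt s]; linarith)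
    set μ : ℝ → (KerrSlab.development hM ha).carrier := fun s ↦
      if h : γ s ∈ KerrSlab.domain a M then ⟨γ s, h⟩ else p
    have hμeq : ∀ (s) (hs : γ s ∈ KerrSlab.domain a M), μ s = ⟨γ s, hs⟩ := fun s hs ↦ dif_pos hs
    have hμ : ∀ s, γ s ∈ KerrSlab.domain a M → (μ s).1 = γ s := fun s hs ↦ by rw [hμeq s hs]
    have h0 : (γ (-(p.1.1 0)) : E4) 0 = 0 := by rw [hγt]; ring
    obtain ⟨y, hy⟩ := KerrSlab.exists_sliceEmbed_eq_iff.2 h0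
    refine LorentzianMetric.chronologicalFuture_subset_causalFuture _ _ _
      ⟨μ (-(p.1.1 0)), ⟨y, ?_⟩, μ, -(p.1.1 0), 0, by linarith, ?_, rfl, ?_⟩
    · rw [hμeq _ (hmem _ le_rfl)]
      exact Subtype.ext hy
    · exact isFutureTimelikeCurveOn_lift hM ha hγ hμ fun s hs ↦ hmem s hs.1
    · rw [hμeq 0 (hmem 0 (by linarith))]
      exact Subtype.ext hγ0
  · -- (b): the helix through `p`, run forwards for parameter time `T − p⁰`
    obtain ⟨γ, hγ0, hγt, hγr, hγ⟩ := stub_kerrHelix M a M hM.le ha p.1 hr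
    have hmem : ∀ s, 0 ≤ s → γ s ∈ KerrSlab.domain a M := fun s hs ↦
      KerrSlab.mem_domain_of_nonneg (by rw [hγt s]; linarith)
    set μ : ℝ → (KerrSlab.development hM ha).carrier := fun s ↦
      if h : γ s ∈ KerrSlab.domain a M then ⟨γ s, h⟩ else p
    have hμeq : ∀ (s) (hs : γ s ∈ KerrSlab.domain a M), μ s = ⟨γ s, hs⟩ := fun s hs ↦ dif_pos hs
    have hμ : ∀ s, γ s ∈ KerrSlab.domain a M → (μ s).1 = γ s := fun s hs ↦ by rw [hμeq s hs]
    refine ⟨μ (T - p.1.1 0), ?_, ?_, p, rfl, μ, 0, T - p.1.1 0, by linarith, ?_, ?_, rfl⟩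
    · rw [hμeq _ (hmem _ (by linarith))]
      exact hγr _
    · rw [hμeq _ (hmem _ (by linarith))]
      change (γ (T - p.1.1 0) : E4) 0 = T
      rw [hγt]
      ring
    · exact isFutureTimelikeCurveOn_lift hM ha hγ hμ fun s hs ↦ hmem s hs.1
    · rw [hμeq 0 (hmem 0 le_rfl)]
      exact Subtype.ext hγ0

end Summit.FinalStateConjecture.FinalStateConjecture.Theorems.ClusterCompleteness

end
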